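import Summits.ABC.ABC.Theorems.SoloBlindFormsBridge
import Summits.ABC.ABC.Theorems.SoloBlindFormsSurplus
import HarnessLib

/-!
# C4″ end to end: no polynomial identity gains exponent

Solo seat `solo-ABC-blind` (ideation tier, summit-directed), session 6.

`identity_no_gain`: for every identity `a + b = c` in `ℤ[X]` (`deg c = n ≥ 1`, `deg a ≤ n`, `a b ≠ 0`,
`a, c` coprime over `ℚ`) with a factorisation `a b c = d · X^α (X − 1)^γ · ∏ᵢ Pᵢ^{eᵢ}` (`eᵢ ≥ 1`) and
every `K ≥ 1`, transporting `PolyABC K` through the identity (`forms_no_gain`,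
Theorems/SoloBlindFormsBridge.lean) yields only a floor `κ' v^θ ≤ rad(u v (v − u))` with `θ ≤ 1/K` —
never more than `PolyABC K` gives through the identity map — because projective Mason–Stothers bounds
the surplus (`surplus_ge_of_identity`, Theorems/SoloBlindFormsSurplus.lean; Mason 1984 [Mason1984]).
The transported exponent is `(n − K s)/K` (`identity_transfer_exponent`), it is `≤ 1/K`
(`identity_transfer_exponent_le`), with equality iff `n = 1, s = 0` or `K = 1 ∧ s = n − 1`
(Belyi-extremal; `identity_lossless_iff`).  This is the statement C4″ of the seat's WALL.md,
kernel-checked end to end (count T38, transfer T39, bridge T40–T42, surplus T43).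
-/

noncomputable section

open Polynomial Finset UniqueFactorizationMonoid
open Literature.NumberTheory.DiophantineGeometry

namespace Summit.ABC.ABC.Theorems

/-- **C4″ (no identity gains), end to end.**  For every identity `a + b = c` in `ℤ[X]` as above and
every `K ≥ 1`, `PolyABC K` transported through the identity yields only a floor
`κ' v^θ ≤ rad(u v (v − u))` with `θ ≤ 1/K` — exactly what `PolyABC K` gives through the identity map
(`radLowerBound_of_polyABC` with `n = 1`).  [folklore consequence of Mason 1984] -/
theorem identity_no_gain {a b c : ℤ[X]} {n : ℕ} (hn : 1 ≤ n) (hsum : a + b = c)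
    (hc : c.natDegree = n) (ha : a.natDegree ≤ n) (ha0 : a ≠ 0) (hb0 : b ≠ 0)
    (hcop : IsCoprime (a.map (Int.castRingHom ℚ)) (c.map (Int.castRingHom ℚ)))
    {m : ℕ} {d : ℤ} {α γ : ℕ} {P : Fin m → ℤ[X]} {e : Fin m → ℕ} (he : ∀ i, 0 < e i)
    (hfac : a * b * c = C d * X ^ α * (X - 1) ^ γ * ∏ i, P i ^ e i)
    {K : ℝ} (hK : 1 ≤ K) (hP : PolyABC K) :
    ∃ θ κ' : ℝ, θ ≤ 1 / K ∧ 0 < κ' ∧ ∀ u v : ℕ, 0 < u → u < v → Nat.Coprime u v →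
      κ' * (v : ℝ) ^ θ ≤ ((radical (u * v * (v - u)) : ℕ) : ℝ) :=
  forms_no_gain hn hsum hc ha ha0 hb0 hcop he hfac
    (surplus_ge_of_identity hn hsum hc ha ha0 hb0 hcop he hfac) hK hP

/-- The transported exponent of an identity with factorisation data is `(n − K·s)/K`, `s = Σ deg Pᵢ`:
`PolyABC K` gives the floor `κ' v^{(n − K s)/K} ≤ rad(u v (v − u))`. [folklore] -/
theorem identity_transfer_exponent {a b c : ℤ[X]} {n : ℕ} (hn : 1 ≤ n) (hsum : a + b = c)
    (hc : c.natDegree = n) (ha : a.natDegree ≤ n) (ha0 : a ≠ 0) (hb0 : b ≠ 0)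
    (hcop : IsCoprime (a.map (Int.castRingHom ℚ)) (c.map (Int.castRingHom ℚ)))
    {m : ℕ} {d : ℤ} {α γ : ℕ} {P : Fin m → ℤ[X]} {e : Fin m → ℕ} (he : ∀ i, 0 < e i)
    (hfac : a * b * c = C d * X ^ α * (X - 1) ^ γ * ∏ i, P i ^ e i)
    {K : ℝ} (hP : PolyABC K) :
    ∃ κ' : ℝ, 0 < κ' ∧ ∀ u v : ℕ, 0 < u → u < v → Nat.Coprime u v →
      κ' * (v : ℝ) ^ (((n : ℝ) - K * (∑ i, (P i).natDegree : ℕ)) / K) ≤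
        ((radical (u * v * (v - u)) : ℕ) : ℝ) :=
  radFloor_of_coveringData (coveringData_of_forms hn hsum hc ha ha0 hb0 hcop he hfac) hP

/-- … and that exponent is `≤ 1/K` for `K ≥ 1` (Mason–Stothers), [folklore] -/
theorem identity_transfer_exponent_le {a b c : ℤ[X]} {n : ℕ} (hn : 1 ≤ n) (hsum : a + b = c)
    (hc : c.natDegree = n) (ha : a.natDegree ≤ n) (ha0 : a ≠ 0) (hb0 : b ≠ 0)
    (hcop : IsCoprime (a.map (Int.castRingHom ℚ)) (c.map (Int.castRingHom ℚ)))
    {m : ℕ} {d : ℤ} {α γ : ℕ} {P : Fin m → ℤ[X]} {e : Fin m → ℕ} (he : ∀ i, 0 < e i)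
    (hfac : a * b * c = C d * X ^ α * (X - 1) ^ γ * ∏ i, P i ^ e i)
    {K : ℝ} (hK : 1 ≤ K) :
    ((n : ℝ) - K * (∑ i, (P i).natDegree : ℕ)) / K ≤ 1 / K :=
  transfer_exponent_le (surplus_ge_of_identity hn hsum hc ha ha0 hb0 hcop he hfac) hK

/-- … with equality (a LOSSLESS identity) iff the identity has degree 1 with no surplus, or `K = 1` and
the identity is Belyi-extremal, `s = n − 1` — the equality case of C4″. [folklore] -/
theorem identity_lossless_iff {a b c : ℤ[X]} {n : ℕ} (hn : 1 ≤ n) (hsum : a + b = c)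
    (hc : c.natDegree = n) (ha : a.natDegree ≤ n) (ha0 : a ≠ 0) (hb0 : b ≠ 0)
    (hcop : IsCoprime (a.map (Int.castRingHom ℚ)) (c.map (Int.castRingHom ℚ)))
    {m : ℕ} {d : ℤ} {α γ : ℕ} {P : Fin m → ℤ[X]} {e : Fin m → ℕ} (he : ∀ i, 0 < e i)
    (hfac : a * b * c = C d * X ^ α * (X - 1) ^ γ * ∏ i, P i ^ e i)
    {K : ℝ} (hK : 1 ≤ K) :
    ((n : ℝ) - K * (∑ i, (P i).natDegree : ℕ)) / K = 1 / K ↔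
      ((∑ i, (P i).natDegree) = 0 ∧ n = 1) ∨ (K = 1 ∧ (∑ i, (P i).natDegree) + 1 = n) :=
  transfer_exponent_eq_iff (surplus_ge_of_identity hn hsum hc ha ha0 hb0 hcop he hfac) hK

end Summit.ABC.ABC.Theorems

end
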